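import Summits.Ventures.WeilGRH.UniformConductorFloorGalerkinTab
import Summits.Ventures.WeilGRH.UniformConductorFloorLog10TableValid
import HarnessLib

/-!
# GRH arm (rh-explicit, venture WeilGRH): the principal character mod `167` FAILS Weil positivity on `[−(log 10)/2, (log 10)/2]` — a TABLE-BASED 32-mode
  kernel Galerkin witness (rung four's razor prime)

Cell `rh-explicit`, WEIL TRACK — GRH ARM (weil-grh-1, gen9).  At the window `(log 10)/2` the flat threshold of the coprime pattern is `164.59 < 167` while the even
Galerkin bottoms of the pseudo-key form are `166.87` (16 modes) and `167.12` (32 modes): the prime `167` FAILS, by a margin that needs `K = 32` modes — beyond the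
table-free evaluator's check-lane budget (`≈ 6·K² ` boxes AND `K` in-kernel records), but cheap on the certified special-value table `Log10Table.tab`
(`UniformConductorFloorLog10Table.lean`, `tab_valid` below `144`): `UniformFloor.galerkinCheckTab` evaluates only the `33·65` entry boxes.  Integer witness =
the bottom eigenvector of the 32-mode section at scale `10⁷` (float form/‖c‖² = `-7.326e-04`).  With `UniformConductorFloorPrincipalLog10.lean` (primes `≤ 163`
fail, `≥ 179` hold) and the door cell mod `173` this completes rung four for PRIME moduli: `U_{(log 10)/2}(p) ↔ p ≥ 173` (`UniformConductorFloorLog10Primes.lean`).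
RH/GRH-free; no definitions; standard axioms.

## References

* H. Yoshida (1992) §3, §5 (5.15)/(5.16) p. 301 [Yoshida1992HermitianForms]; R. E. Moore (1966) Ch. 3 [Moore1966]; A. Weil (1952) (11) [Weil1952FormulesExplicites].
-/

set_option autoImplicit false

open scoped ComplexConjugate

namespace Summit.Ventures.WeilGRH

open Literature.NumberTheory.LFunctions Literature.NumberTheory.LFunctions.Yoshida1992
open Literature.NumberTheory.LFunctions.Yoshida1992.Encl
open Literature.Analysis.ValidatedNumerics.NumericsMP
open Summit.Ventures.WeilGRH.Log10Table

namespace UniformFloor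

set_option maxHeartbeats 0 in
set_option maxRecDepth 200000 in
/-- kernel: the table-based 32-mode Galerkin witness for `χ₀` mod `167` at `(log 10)/2` (all seven prime powers coprime: `ε = 1`; `log 167` by `MI.logNat`).
[cite: Moore1966, Ch. 3 (interval arithmetic: inclusion property)] -/
theorem galerkinTab_log10half_167 :
    ((MI.logNat (2 ^ 80) 96 167).elim false fun LQ ↦
      galerkinCheckTab (2 ^ 80) C tab LQ [1, 1, 1, 1, 1, 1, 1]
      [9986718, -273011, 28879, 20817, -45690, 137548, -33285, 74859, 63048, 67426,
      -19058, 61492, -38877, 47326, 12889, 25906, -9701, 76296, -28822, 51037,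
      -20449, -357, -12888, 12050, -18229, 13651, -10683, -3151, -2473, 4860,
      -27790, 4057, -20460] 32) = true := by
  decide +kernel

/-- ★★ **The principal character mod `167` FAILS Weil positivity on `[−(log 10)/2, (log 10)/2]`.** [cite: Yoshida1992HermitianForms, §5 (5.15)-(5.16) p. 301] -/
theorem not_weilPositivityOnChar_log10half_principal_mod_167 :
    ¬ WeilPositivityOnChar (1 : DirichletCharacter ℂ 167) (Real.log 10 / 2) := by
  have hfact := galerkinTab_log10half_167
  cases hL : MI.logNat (2 ^ 80) 96 167 with
  | none => rw [hL] at hfact; simp at hfact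
  | some LQ =>
    rw [hL, Option.elim_some] at hfact
    have hLQ : MI.mem (2 ^ 80) (Real.log ((167 : ℕ) : ℝ)) LQ := MI.mem_logNat (by norm_num) hL
    have hreal : ∀ n : ℕ, conj ((1 : DirichletCharacter ℂ 167) (n : ZMod 167)) = (1 : DirichletCharacter ℂ 167) (n : ZMod 167) := by
      intro n
      by_cases hx : IsUnit ((n : ℕ) : ZMod 167)
      · rw [MulChar.one_apply hx, map_one]
      · rw [MulChar.map_nonunit _ hx, map_zero]
    have heven : charParity (1 : DirichletCharacter ℂ 167) = 0 :=
      charParity_of_even (show (1 : DirichletCharacter ℂ 167) (-1) = 1 from MulChar.one_apply isUnit_one.neg)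
    have hε : ∀ i < ks.length, ((1 : DirichletCharacter ℂ 167) (((ks.getD i default).val : ℕ) : ZMod 167)).re =
        (([1, 1, 1, 1, 1, 1, 1].getD i 0 : ℤ) : ℝ) := by
      intro i hi
      have hi7 : i < 7 := by simpa [ks] using hi
      interval_cases i
      · show ((1 : DirichletCharacter ℂ 167) (((PrimeLen.val ⟨2, 1⟩ : ℕ)) : ZMod 167)).re = (((1 : ℤ)) : ℝ)
        rw [show (PrimeLen.val ⟨2, 1⟩ : ℕ) = 2 from rfl,
          MulChar.one_apply (show IsUnit ((2 : ℕ) : ZMod 167) by rw [ZMod.isUnit_iff_coprime]; decide)]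
        simp
      · show ((1 : DirichletCharacter ℂ 167) (((PrimeLen.val ⟨3, 1⟩ : ℕ)) : ZMod 167)).re = (((1 : ℤ)) : ℝ)
        rw [show (PrimeLen.val ⟨3, 1⟩ : ℕ) = 3 from rfl,
          MulChar.one_apply (show IsUnit ((3 : ℕ) : ZMod 167) by rw [ZMod.isUnit_iff_coprime]; decide)]
        simp
      · show ((1 : DirichletCharacter ℂ 167) (((PrimeLen.val ⟨2, 2⟩ : ℕ)) : ZMod 167)).re = (((1 : ℤ)) : ℝ)
        rw [show (PrimeLen.val ⟨2, 2⟩ : ℕ) = 4 from rfl,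
          MulChar.one_apply (show IsUnit ((4 : ℕ) : ZMod 167) by rw [ZMod.isUnit_iff_coprime]; decide)]
        simp
      · show ((1 : DirichletCharacter ℂ 167) (((PrimeLen.val ⟨5, 1⟩ : ℕ)) : ZMod 167)).re = (((1 : ℤ)) : ℝ)
        rw [show (PrimeLen.val ⟨5, 1⟩ : ℕ) = 5 from rfl,
          MulChar.one_apply (show IsUnit ((5 : ℕ) : ZMod 167) by rw [ZMod.isUnit_iff_coprime]; decide)]
        simp
      · show ((1 : DirichletCharacter ℂ 167) (((PrimeLen.val ⟨7, 1⟩ : ℕ)) : ZMod 167)).re = (((1 : ℤ)) : ℝ)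
        rw [show (PrimeLen.val ⟨7, 1⟩ : ℕ) = 7 from rfl,
          MulChar.one_apply (show IsUnit ((7 : ℕ) : ZMod 167) by rw [ZMod.isUnit_iff_coprime]; decide)]
        simp
      · show ((1 : DirichletCharacter ℂ 167) (((PrimeLen.val ⟨2, 3⟩ : ℕ)) : ZMod 167)).re = (((1 : ℤ)) : ℝ)
        rw [show (PrimeLen.val ⟨2, 3⟩ : ℕ) = 8 from rfl,
          MulChar.one_apply (show IsUnit ((8 : ℕ) : ZMod 167) by rw [ZMod.isUnit_iff_coprime]; decide)]
        simp
      · show ((1 : DirichletCharacter ℂ 167) (((PrimeLen.val ⟨3, 2⟩ : ℕ)) : ZMod 167)).re = (((1 : ℤ)) : ℝ)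
        rw [show (PrimeLen.val ⟨3, 2⟩ : ℕ) = 9 from rfl,
          MulChar.one_apply (show IsUnit ((9 : ℕ) : ZMod 167) by rw [ZMod.isUnit_iff_coprime]; decide)]
        simp
    have h := not_weilPositivityOnChar_of_galerkinCheckTab (by norm_num) a_pos primeData consts_valid tab_valid (by norm_num : 32 < 144)
      hLQ hfact (by norm_num) 1 hreal heven hε
    simpa only [a] using h

/-- **So the all-characters statement at `(log 10)/2` fails at `p = 167`.** [cite: Weil1952FormulesExplicites, (11) pp. 261–262] -/
theorem exists_not_weilPositivityOnChar_log10half_mod_167 :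
    ∃ χ : DirichletCharacter ℂ 167, ¬ WeilPositivityOnChar χ (Real.log 10 / 2) :=
  ⟨1, not_weilPositivityOnChar_log10half_principal_mod_167⟩

end UniformFloor

end Summit.Ventures.WeilGRH
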